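import Literature.Computability.Cryptography.LWEPrimePowerSolverData
import Literature.Computability.Cryptography.LWEPrimePowerIdeal
import HarnessLib

/-!
# The per-input solver of the Micciancio–Peikert reduction, II: tests, digit rounds, loops and the whole solver have the law `idealLaw` (MP12, Thm. 3.1, machine bridge)

Topic `Computability/Cryptography` (LWE), grouping namespace `LWE.MP12`, sequel of
`LWEPrimePowerSolverData.lean` (items, estimation answers and digit trials computed from raw data) and
`LWEPrimePowerIdeal.lean` (`digitsLaw`, `idealLaw`). Proved material (no named fact) towards
`Literature.Computability.Cryptography.blprs_gapSVP_sqrt_dim_to_lwe_classical` (**pqc.S21**),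
component Thm. 2.17 = Micciancio–Peikert 2012, Thm. 3.1 (hypothesis `h₂` of
`BLPRSReduction.…_of_components`).

The deterministic solver `solveDet` reads STRUCTURED raw material — for phase 1 the estimation units of
the `e+1` levels, for phase 2 the round data of every coordinate (`e` rounds provisioned, `e - i⋆`
used), for phase 3 the `m'` raw samples — every piece carrying the coin slices of its oracle calls,
and computes: the answers of phase 1 (`estAll`), the selected step `i⋆`, for every coordinate the digit
loop driven by its round data (`digitsDet`, `LWEPrimePowerDriven.loopDet` of the rounds `stepDet` of
the tests `testDet`), and the rounded top system solved by `F`. When the raw material has its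
product law (`inputLaw`: independent pieces, each with the law of `LWEPrimePowerSolverData.lean`), the
output of `solveDet` has EXACTLY the law `idealLaw K χK χ₁ N T N' m' γ F s` of the analysis with the
kernel `K u = U_C.map (f u)` (**`law_solveDet`**); so `LWEPrimePowerFailure.eventually_idealLaw_ne_le`
bounds its failure probability.

## References

* D. Micciancio, C. Peikert, *Trapdoors for lattices: simpler, tighter, faster, smaller*, EUROCRYPT 2012,
  LNCS 7237; full version IACR ePrint 2011/501, §3, proof of Thm. 3.1, pp. 15–16. [MicciancioPeikert2012]
* S. Arora, B. Barak, *Computational Complexity: A Modern Approach*, CUP 2009, Def. 7.1.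
  [AroraBarak2009]
-/

noncomputable section

open scoped ENNReal

namespace Literature.Computability.Cryptography

namespace LWE

namespace MP12

open Literature.Probability.Distributions

/-! ### Prefixes of iid tuples and of the driven loop -/

section Prefix

variable {α : Type} {p : ℕ} {RD : Type}

/-- **A prefix of an iid tuple is iid.** [folklore] -/
theorem iidPMF_map_comp_castLE (P : PMF α) {n' n : ℕ} (h : n' ≤ n) :
    (iidPMF P n).map (fun v : Fin n → α => fun i : Fin n' => v (Fin.castLE h i)) = iidPMF P n' := by
  obtain ⟨r, rfl⟩ := Nat.exists_eq_add_of_le h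
  rw [← prodLaw_map_fst (iidPMF P n') (iidPMF P r), ← iidPMF_map_appendEquiv_symm, PMF.map_comp]
  rfl

/-- The first `k ≤ n'` rounds of the driven loop read only the first `n'` data. [folklore] -/
theorem loopDet_comp_castLE (stepS : RD → ℕ → ℕ → (Fin p → Bool)) {n' n : ℕ} (h : n' ≤ n) (dats : Fin n → RD) :
    ∀ {k : ℕ}, k ≤ n' → loopDet stepS (fun i : Fin n' => dats (Fin.castLE h i)) k = loopDet stepS dats k
  | 0, _ => rfl
  | k + 1, hk => by
    have hk' : k < n' := hk
    simp only [loopDet, dif_pos hk', dif_pos (lt_of_lt_of_le hk' h), loopDet_comp_castLE stepS h dats hk'.le]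
    rfl

/-- **The driven loop run for `k ≤ n` of `n` provisioned rounds has the law `loopLaw … k`.**
[cite: MicciancioPeikert2012, Thm. 3.1 proof (p. 16)] -/
theorem iidPMF_map_loopDet_of_le (stepS : RD → ℕ → ℕ → (Fin p → Bool)) (P : PMF RD) {k n : ℕ}
    (h : k ≤ n) :
    (iidPMF P n).map (fun dats => loopDet stepS dats k) = loopLaw (fun i L => P.map fun d => stepS d i L) k := by
  rw [← iidPMF_map_loopDet stepS P k, ← iidPMF_map_comp_castLE P h, PMF.map_comp]
  congr 1
  funext dats
  exact (loopDet_comp_castLE stepS h dats le_rfl).symm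

end Prefix

/-! ### The test, the round, the loop -/

section Digits

variable {d : ℕ} {p : ℕ} [hp : Fact p.Prime] {e : ℕ} (K' m N T : ℕ) (γ : ℝ) {C : Type} [Fintype C] [Nonempty C]
  (i₀ : ℕ) (f : (Fin m → (Fin d → ZMod (p ^ e)) × ZMod (p ^ e)) → C → Bool)

open Classical in
/-- **The `T`-trial test** for coordinate `c`, multiplier `cm`, candidate shift `t`: "does some trial
say level `i⋆`?". [cite: MicciancioPeikert2012, Thm. 3.1 proof (p. 16)] -/
def testDet (c : Fin d) (cm : ZMod (p ^ e)) (t : Fin d → ZMod (p ^ e)) (tds : Fin T → TrialData (Fin d) p e K' m N C) : Bool :=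
  decide (says0 N γ fun t' => trialVerdicts K' m N i₀ f c cm t (tds t'))

/-- **The test computed from raw data has the law `testOut`.** [cite: MicciancioPeikert2012, Thm. 3.1 proof (p. 16)] -/
theorem law_testDet (χ₁ : PMF (ZMod (p ^ e))) (s : Fin d → ZMod (p ^ e)) (c : Fin d) (cm : ZMod (p ^ e))
    (t : Fin d → ZMod (p ^ e)) :
    (iidPMF (trialDataLaw K' m N χ₁ s (C := C)) T).map (testDet K' m N T γ i₀ f c cm t) =
      testOut (fun u => (PMF.uniformOfFintype C).map (f u)) (sumNoise (p ^ e) χ₁ (K' + 1)) N T γ i₀ c cm t s := by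
  rw [testOut, digitAmpAns, ← law_trialVerdicts K' m N i₀ f χ₁ s c cm t, ← iidPMF_map, PMF.map_comp]
  rfl

/-- **The round data**: the trial data of the `p` candidates. [folklore] -/
abbrev RoundData (d p e K' m N T : ℕ) (C : Type) := Fin p → Fin T → TrialData (Fin d) p e K' m N C

/-- **The verdicts of one digit round** for coordinate `c` at position `i'` from the state `L`.
[cite: MicciancioPeikert2012, Thm. 3.1 proof (p. 16)] -/
def stepDet (c : Fin d) (rd : RoundData d p e K' m N T C) (i' L : ℕ) : Fin p → Bool :=
  fun k => testDet K' m N T γ i₀ f c (gen p e (i₀ + 1 + i')) (candShift c i' L k) (rd k)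

/-- The law of the round data. [folklore] -/
def roundDataLaw (χ₁ : PMF (ZMod (p ^ e))) (s : Fin d → ZMod (p ^ e)) : PMF (RoundData d p e K' m N T C) :=
  iidPMF (iidPMF (trialDataLaw K' m N χ₁ s) T) p

/-- **The round computed from raw data has the law `stepLaw`.** [cite: MicciancioPeikert2012, Thm. 3.1 proof (p. 16)] -/
theorem law_stepDet (χ₁ : PMF (ZMod (p ^ e))) (s : Fin d → ZMod (p ^ e)) (c : Fin d) (i' L : ℕ) :
    (roundDataLaw K' m N T χ₁ s (C := C)).map (fun rd => stepDet K' m N T γ i₀ f c rd i' L) =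
      stepLaw (fun u => (PMF.uniformOfFintype C).map (f u)) (sumNoise (p ^ e) χ₁ (K' + 1)) N T γ i₀ c s i' L := by
  rw [roundDataLaw, stepLaw,
    show (fun rd : RoundData d p e K' m N T C => stepDet K' m N T γ i₀ f c rd i' L) =
      fun (rd : RoundData d p e K' m N T C) (k : Fin p) =>
        testDet K' m N T γ i₀ f c (gen p e (i₀ + 1 + i')) (candShift c i' L k) (rd k) from rfl,
    iidPMF_map_pi, indepLaw_eq_piLaw]
  congr 1
  funext k
  exact law_testDet K' m N T γ i₀ f χ₁ s c _ _

/-- **The digit loop of coordinate `c` driven by its round data**, `n` rounds. [cite: MicciancioPeikert2012, Thm. 3.1 proof (p. 16)] -/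
def digitsDet {e' : ℕ} (c : Fin d) (dats : Fin e' → RoundData d p e K' m N T C) (n : ℕ) : ℕ :=
  loopDet (fun rd i' L => stepDet K' m N T γ i₀ f c rd i' L) dats n

/-- **The driven digit loop has the law `loopLaw (stepLaw …) n`** (`n ≤ e'` rounds of `e'` provisioned).
[cite: MicciancioPeikert2012, Thm. 3.1 proof (p. 16)] -/
theorem law_digitsDet (χ₁ : PMF (ZMod (p ^ e))) (s : Fin d → ZMod (p ^ e)) (c : Fin d) {n e' : ℕ} (h : n ≤ e') :
    (iidPMF (roundDataLaw K' m N T χ₁ s (C := C)) e').map (fun dats => digitsDet K' m N T γ i₀ f c dats n) =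
      loopLaw (stepLaw (fun u => (PMF.uniformOfFintype C).map (f u)) (sumNoise (p ^ e) χ₁ (K' + 1)) N T γ i₀ c s) n := by
  unfold digitsDet
  rw [iidPMF_map_loopDet_of_le _ _ h]
  congr 1
  funext i' L
  exact law_stepDet K' m N T γ i₀ f χ₁ s c i' L

end Digits

/-! ### The whole solver -/

section Solver

variable {d : ℕ} {p : ℕ} [hp : Fact p.Prime] {e : ℕ} (K' m N T N' m' : ℕ) (γ : ℝ) {C : Type} [Fintype C] [Nonempty C]
  (f : (Fin m → (Fin d → ZMod (p ^ e)) × ZMod (p ^ e)) → C → Bool)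
  (F : ℕ → (Fin m' → (Fin d → ZMod (p ^ e)) × ZMod (p ^ e)) → (Fin m' → ZMod (p ^ e)) → (Fin d → ZMod (p ^ e)))

/-- **The phase-1 data**: for each level, `N'` estimation units with coins. [folklore] -/
abbrev EstData (d p e K' m N' : ℕ) (C : Type) := Fin (e + 1) → Fin N' → EstUnit (Fin d) p e K' m × C

/-- **The phase-2 data**: for each coordinate, `e` rounds of round data. [folklore] -/
abbrev DigData (d p e K' m N T : ℕ) (C : Type) := Fin d → Fin e → RoundData d p e K' m N T C

/-- **The whole input of the solver**: phase-1 data, phase-2 data, the `m'` raw samples of phase 3. [folklore] -/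
abbrev Input (d p e K' m N T N' m' : ℕ) (C : Type) :=
  EstData d p e K' m N' C × (DigData d p e K' m N T C × (Fin m' → (Fin d → ZMod (p ^ e)) × ZMod (p ^ e)))

/-- All answers of phase 1. [cite: MicciancioPeikert2012, Thm. 3.1 proof (p. 15)] -/
def estAll (est : EstData d p e K' m N' C) : Fin (e + 1) → Fin N' → Bool :=
  fun j => estAnswers K' m N' f j (est j)

/-- **The deterministic solver**: phase 1 and the selected step, the digit loops of every coordinate at
that step for `e - i⋆` rounds, then round the raw samples and solve.
[cite: MicciancioPeikert2012, Thm. 3.1 proof (pp. 15–16)] -/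
def solveDet (inp : Input d p e K' m N T N' m' C) : Fin d → ZMod (p ^ e) :=
  let i₀ := selectStep e N' (estAll K' m N' f inp.1)
  recoverTop (e - i₀) (F (e - i₀)) inp.2.2 fun c => ((digitsDet K' m N T γ i₀ f c (inp.2.1 c) (e - i₀) : ℕ) : ZMod (p ^ e))

/-- The law of the phase-1 data. [folklore] -/
def estDataLaw (χ₁ : PMF (ZMod (p ^ e))) (s : Fin d → ZMod (p ^ e)) : PMF (EstData d p e K' m N' C) :=
  iidPMF (iidPMF (prodLaw (estUnitLaw K' m χ₁ s) (PMF.uniformOfFintype C)) N') (e + 1)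

/-- The law of the phase-2 data. [folklore] -/
def digDataLaw (χ₁ : PMF (ZMod (p ^ e))) (s : Fin d → ZMod (p ^ e)) : PMF (DigData d p e K' m N T C) :=
  iidPMF (iidPMF (roundDataLaw K' m N T χ₁ s) e) d

/-- **The law of the whole input**: the three phases independent. [folklore] -/
def inputLaw (χ₁ : PMF (ZMod (p ^ e))) (s : Fin d → ZMod (p ^ e)) : PMF (Input d p e K' m N T N' m' C) :=
  prodLaw (estDataLaw K' m N' χ₁ s) (prodLaw (digDataLaw K' m N T χ₁ s) (lweSamples χ₁ s m'))

/-- **Phase 1 has the law `estLaw`.** [cite: MicciancioPeikert2012, Thm. 3.1 proof (p. 15)] -/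
theorem law_estAll (χ₁ : PMF (ZMod (p ^ e))) (s : Fin d → ZMod (p ^ e)) :
    (estDataLaw K' m N' χ₁ s (C := C)).map (estAll K' m N' f) =
      estLaw (fun u => (PMF.uniformOfFintype C).map (f u)) (sumNoise (p ^ e) χ₁ (K' + 1)) (gen p e) e N' := by
  refine (iidPMF_map_pi (iidPMF (prodLaw (estUnitLaw K' m χ₁ s) (PMF.uniformOfFintype C)) N') (e + 1)
    (fun (j : Fin (e + 1)) us => estAnswers K' m N' f j us)).trans ?_
  rw [estLaw, indepLaw_eq_piLaw]
  congr 1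
  funext j
  exact law_estAnswers K' m N' f χ₁ s j

/-- **Phase 2 has the law `digitsLaw a s`** at the step selected from `a`. [cite: MicciancioPeikert2012, Thm. 3.1 proof (p. 16)] -/
theorem law_digits (χ₁ : PMF (ZMod (p ^ e))) (s : Fin d → ZMod (p ^ e)) (a : Fin (e + 1) → Fin N' → Bool) :
    (digDataLaw K' m N T χ₁ s (C := C)).map (fun dig c =>
        ((digitsDet K' m N T γ (selectStep e N' a) f c (dig c) (e - selectStep e N' a) : ℕ) : ZMod (p ^ e))) =
      digitsLaw (fun u => (PMF.uniformOfFintype C).map (f u)) (sumNoise (p ^ e) χ₁ (K' + 1)) N T N' γ a s := by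
  refine (iidPMF_map_pi (iidPMF (roundDataLaw K' m N T χ₁ s) e) d (fun (c : Fin d) dats =>
    ((digitsDet K' m N T γ (selectStep e N' a) f c dats (e - selectStep e N' a) : ℕ) : ZMod (p ^ e)))).trans ?_
  rw [digitsLaw, indepLaw_eq_piLaw]
  congr 1
  funext c
  rw [← law_digitsDet K' m N T γ _ f χ₁ s c (Nat.sub_le e _), PMF.map_comp]
  rfl

/-- **The solver computed from raw data has the law `idealLaw`** of the analysis, for every secret.
[cite: MicciancioPeikert2012, Thm. 3.1 proof (pp. 15–16)] -/
theorem law_solveDet (χ₁ : PMF (ZMod (p ^ e))) (s : Fin d → ZMod (p ^ e)) :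
    (inputLaw K' m N T N' m' χ₁ s (C := C)).map (solveDet K' m N T N' m' γ f F) =
      idealLaw (fun u => (PMF.uniformOfFintype C).map (f u)) (sumNoise (p ^ e) χ₁ (K' + 1)) χ₁ N T N' m' γ F s := by
  rw [inputLaw, prodLaw_map_eq_bind_fst, idealLaw, ← law_estAll K' m N' f χ₁ s, PMF.bind_map]
  refine congrArg _ (funext fun est => ?_)
  rw [Function.comp_apply, ← law_digits K' m N T N' γ f χ₁ s, PMF.bind_map, prodLaw_map_eq_bind_fst]
  rfl

end Solver

end MP12

end LWE

end Literature.Computability.Cryptography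

end
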